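import Mathlib
import HarnessLib
import Literature.Analysis.FluidPDE.ClassicalSolution
import Literature.Analysis.FluidPDE.VectorCalculus
import Literature.Analysis.FluidPDE.NSBoundedMildOseen
import Literature.Analysis.UnboundedOperators.HeatKernel
import Summits.NavierStokesRegularity.NavierStokesRegularity.Theorems.UnthreadedRigidityDoorUnthreadedRigidityVirialHornDefs

/-!
# Route `UnthreadedRigidityDoor`, item `UnthreadedRigidity` (W2, stmt-NavierStokesRegularity-27585) — LINE g11-2 «MIXED PAIR»
# (planner ns-idea-6 g11/g12; idea-crit-7 PASS v1.4): THE TYPED OBJECTS AND STATEMENTS of the line (Theorems-side twin of the sketch, part 1)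

Definition file (Theorems-side twin of the files-only line sketch `pub/ideators/ns-idea-6/lines/UnthreadedRigidityDoor/MixedPair_sketch.lean`
v1.4, sha16 fdd225c37c2e9dbd; namespace `…Theorems.UnthreadedRigidity.MixedPair` instead of the sketch's `…Cruxes.UnthreadedRigidity.MixedPair`;
every def/Prop BODY below is VERBATIM; the shared objects `E3`, `threadingFlux`, `IsSliceAxisymmetric` (PROFILE HORN twin p689891) and `e`, `det3`,
`vortAmpL`, `VirialAdmissible`, `sepShellL`, `WindowAxisUniform` (VIRIAL HORN twin p695782) are NOT re-declared — they are the byte-identical landed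
objects, opened into this namespace; the sketch's `import …Theses.UnthreadedRigidityDoor` is dropped here — no body uses a Theses symbol; the
restriction-of-the-crux composition lives in `…MixedPairCompositions.lean`).  Purpose: the supports S-L / S-X / S-D / S-QU / S-H and the bridges of
LINE g11-2 can be stated and discharged BY NAME from `Theorems/`.  Filed by engine-1 g71 (DIRECTOR-NS dss_147 (3)); author of the statements:
planner ns-idea-6 g11/g12.  Part 2 (the magic-angle sector: `IsMagic`, `HasCore`, G-bridges, `HelmholtzLinkedNull`, `PellBranchPositivity`,
`UniaxialQuadShellAxisym`, AE rungs) is `…MixedPairMagicDefs.lean`.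

THE LINE (sketch docstring, abridged).  THE COUNTEREXAMPLE, BUILT: a DIPOLE + QUADRUPOLE pair `u₀ = curl curl((H₁(r) a·y + H₂(r) yᵀQy) y)` is silent
at order one iff the profiles are LINKED (`H₁K₂ ≡ 3H₂K₁`); WHERE IT BREAKS: at order two (oblique shapes by the virial theorem unless magic-angle
uniaxial; equatorial shapes by the `V′`-dichotomy and the Helmholtz pair).  Objects: `dipoleHarmonic`, `quadHarmonic`, `IsTracelessSymmetric`,
`pairShell`, `PairAdmissible`, `IsNullProfile`, `IsCoaxial`, `IsUniaxial`, `IsEquatorial`, `IsOblique`, `IsTransverse`, `IsLinked`, `IsHelmholtzLinked`.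
Statements: `LinkedPairExists`, `OrderOneLawPair` (O1), `OrderOneSilenceLinks` (S-L), `CoaxialPairAxisym` (S-X), `ObliqueVirialRigidity` (O2a),
`EquatorialDichotomy` (O2b), `HelmholtzPairDead` (S-H), `DipoleShellAxisym` (S-D), `QuadShellOrderTwoRigidity` (S-Q), `MixedPairOrderTwoRigidity`
(slice rung), `PairWindowReduction` (O-W), `HelmholtzWindowDead` (S-HW), `QuadShellWindowAxisym` (S-QW), `MixedPairWindowRigidity` (window rung), `UniaxialQuadShellAxisym` (S-QU, v1.4).

WHAT THIS IS NOT: no NS-regularity statement is touched; `UnthreadedRigidity` (27585), W2 and NS regularity stay OPEN; these are the objects of one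
RUNG line on the wall item; nobody here claims `UnthreadedRigidity`.  `--supports stmt-NavierStokesRegularity-27585 --as helper`.
[cite: MajdaBertozziCUP2002, §1.1 (vector identities)]
-/

-- the summit and its single sub-problem share the name (CONVENTIONS §1)
set_option linter.dupNamespace false

namespace Summit.NavierStokesRegularity.NavierStokesRegularity.Theorems.UnthreadedRigidity.MixedPair

open scoped Topology
open Filter Set
open Summit.NavierStokesRegularity.NavierStokesRegularity.Theorems.UnthreadedRigidity.ProfileHorn (E3 threadingFlux IsSliceAxisymmetric)
open Summit.NavierStokesRegularity.NavierStokesRegularity.Theorems.UnthreadedRigidity.VirialHorn (e det3 vortAmpL VirialAdmissible sepShellL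
  WindowAxisUniform)

/-! ## The mixed pair: dipole shell + quadrupole shell about the same centre -/

/-- `Y₁(y) = a·y` (solid harmonic of degree 1). -/
noncomputable def dipoleHarmonic (a : E3) : E3 → ℝ := fun y => inner ℝ a y

/-- `Y₂(y) = yᵀQy` (solid harmonic of degree 2 when `Q` is symmetric and traceless). -/
noncomputable def quadHarmonic (Q : E3 →L[ℝ] E3) : E3 → ℝ := fun y => inner ℝ (Q y) y

/-- `Q` symmetric with trace zero. -/
def IsTracelessSymmetric (Q : E3 →L[ℝ] E3) : Prop :=
  (∀ v w : E3, inner ℝ (Q v) w = inner ℝ v (Q w)) ∧ ∑ i : Fin 3, inner ℝ (Q (e i)) (e i) = 0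

/-- the MIXED PAIR `u₀ = curl curl ((H₁(|y|) a·y + H₂(|y|) yᵀQy) y)`, `y = x − x₀`. -/
noncomputable def pairShell (H₁ H₂ : ℝ → ℝ) (a : E3) (Q : E3 →L[ℝ] E3) (x₀ : E3) : E3 → E3 :=
  fun x => sepShellL H₁ (dipoleHarmonic a) x₀ x + sepShellL H₂ (quadHarmonic Q) x₀ x

/-- admissible pair data: a genuine axis, a traceless symmetric `Q`, virial-admissible profiles of degrees 1 and 2. -/
def PairAdmissible (H₁ H₂ : ℝ → ℝ) (a : E3) (Q : E3 →L[ℝ] E3) : Prop :=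
  a ≠ 0 ∧ IsTracelessSymmetric Q ∧ VirialAdmissible 1 H₁ ∧ VirialAdmissible 2 H₂

/-- the null profile. -/
def IsNullProfile (H : ℝ → ℝ) : Prop := ∀ r : ℝ, 0 ≤ r → H r = 0

/-- COAXIAL: `Q` is zonal about `a` (`{a·y, yᵀQy} = 2det[y,a,Qy] ≡ 0`); then the pair is trivially axisymmetric about `a`. -/
def IsCoaxial (a : E3) (Q : E3 →L[ℝ] E3) : Prop := ∀ y : E3, det3 y a (Q y) = 0

/-- UNIAXIAL quadrupole: `yᵀQy = λ(3(b·y)² − |b|²|y|²)` for some axis `b ≠ 0` (repeated eigenvalue; `Y_Q` zonal about `b`; `Q = 0` allowed). -/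
def IsUniaxial (Q : E3 →L[ℝ] E3) : Prop :=
  ∃ (b : E3) (c : ℝ), b ≠ 0 ∧ ∀ y : E3, quadHarmonic Q y = c * (3 * inner ℝ b y ^ 2 - ‖b‖ ^ 2 * ‖y‖ ^ 2)

/-- EQUATORIAL quadrupole (relative to the dipole axis `a`): `Qa = 0`, i.e. `Y_Q` has `O(2)_a`-weights `±2` only (`Q = Q^⊥`). -/
def IsEquatorial (a : E3) (Q : E3 →L[ℝ] E3) : Prop := Q a = 0

/-- OBLIQUE quadrupole: no zonal part along `a` (`Q_aa = 0`), a genuine weight-`±1` part (`Qa ≠ 0`), and not uniaxial.  (The only traceless `Q` with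
`Q_aa = 0`, `Qa ≠ 0` that IS uniaxial is the MAGIC-ANGLE quadrupole: zonal about an axis `b` with `(a·b)² = |a|²|b|²/3` — the named residual.) -/
def IsOblique (a : E3) (Q : E3 →L[ℝ] E3) : Prop := inner ℝ (Q a) a = 0 ∧ Q a ≠ 0 ∧ ¬ IsUniaxial Q

/-- TRANSVERSE = the class decided by this line: `Q_aa = 0` and, if the weight-1 part is present, `Q` is not uniaxial (equatorial ∪ oblique). -/
def IsTransverse (a : E3) (Q : E3 →L[ℝ] E3) : Prop := inner ℝ (Q a) a = 0 ∧ (Q a ≠ 0 → ¬ IsUniaxial Q)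

/-- LINKED profiles: `H₁K₂ ≡ 3H₂K₁` on `(0,∞)` — by the ORDER-ONE LAW exactly the order-one-silent non-coaxial pairs. -/
def IsLinked (H₁ H₂ : ℝ → ℝ) : Prop :=
  ∀ r : ℝ, 0 < r → H₁ r * vortAmpL 2 H₂ r = 3 * (H₂ r * vortAmpL 1 H₁ r)

/-- HELMHOLTZ-LINKED: `K₁ = cH₁`, `K₂ = 3cH₂` with one constant `c` (`V ≡ c`): `Δu₁ = c u₁`, `Δu₂ = 3c u₂`.  For `c < 0` the regular solutions are
`H₁ = A j₁(kr)/r`, `H₂ = B j₂(√3kr)/r²`, `c = −k²`. -/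
def IsHelmholtzLinked (H₁ H₂ : ℝ → ℝ) : Prop :=
  ∃ c : ℝ, ∀ r : ℝ, 0 < r → vortAmpL 1 H₁ r = c * H₁ r ∧ vortAmpL 2 H₂ r = 3 * c * H₂ r

/-! ## The counterexample survives order one -/

/-- CONSTRUCTION «LINKED PAIRS EXIST» (support, S–M): there are virial-admissible, non-null, LINKED profiles with `H₁ > 0` (sketch, CARD §1: pick
`H₁ > 0` smooth-even, `= r^{-3}` outside `[0,R]`; `V := K₁/H₁` is smooth, even, compactly supported; `H₂` = the regular solution of
`H″ + 6H′/r = 3VH`; it decays (`∝ r^{-5}` beyond `R`) iff `−Δ_{ℝ⁷} + 3V` has a zero-energy state, which happens along any path of `H₁`'s from a shallow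
to a deep well — intermediate value theorem on the exterior constant). -/
def LinkedPairExists : Prop :=
  ∃ H₁ H₂ : ℝ → ℝ, VirialAdmissible 1 H₁ ∧ VirialAdmissible 2 H₂ ∧ ¬ IsNullProfile H₁ ∧ ¬ IsNullProfile H₂ ∧
    (∀ r : ℝ, 0 ≤ r → 0 < H₁ r) ∧ IsLinked H₁ H₂

/-- BRIDGE O1 «ORDER-ONE LAW FOR THE PAIR» (M–L; every slice-level item carries the flux-regularity hypothesis `ContDiffWithinAt ℝ 2 … (Ici t₀) t₀`
so that a junk `iteratedDerivWithin` of a rough solution cannot satisfy or falsify it — critic T1 on g11-1).  L = CARD §1 (hand proof for all degree pairs; exact symbolic check kit j323443 PART 2 and j323459):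
`c₁ = −(2H₁K₂ − 6H₂K₁)·{a·y, yᵀQy} = −4(H₁K₂ − 3H₂K₁)·det[y,a,Qy]`.  M = the one-sided first jet of the threading flux of the classical solution equals
the formal jet (as in g9/g10/g11-1). -/
def OrderOneLawPair : Prop :=
  ∀ (t₀ T : ℝ) (u : ℝ → E3 → E3) (p : ℝ → E3 → ℝ) (x₀ a : E3) (Q : E3 →L[ℝ] E3) (H₁ H₂ : ℝ → ℝ),
    t₀ < T →
    Literature.Analysis.FluidPDE.IsClassicalNSSolutionOn (Set.Ico t₀ T) 1 0 u p →
    (∀ t ∈ Set.Ico t₀ T, Tendsto (p t) (cocompact E3) (𝓝 0)) →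
    (∀ x : E3, ContDiffWithinAt ℝ 2 (fun t => threadingFlux u x₀ t x) (Set.Ici t₀) t₀) →
    PairAdmissible H₁ H₂ a Q → u t₀ = pairShell H₁ H₂ a Q x₀ →
    ∀ x : E3, iteratedDerivWithin 1 (fun t => threadingFlux u x₀ t x) (Set.Ici t₀) t₀ =
      -4 * ((H₁ ‖x - x₀‖ * vortAmpL 2 H₂ ‖x - x₀‖ - 3 * (H₂ ‖x - x₀‖ * vortAmpL 1 H₁ ‖x - x₀‖)) *
        det3 (x - x₀) a (Q (x - x₀)))

/-- S-L «ORDER-ONE SILENCE LINKS THE PROFILES» (support, S): if the pair is not coaxial, `det[y,a,Qy]` is a nonzero quadratic polynomial, hence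
nonzero on a dense subset of every sphere, so `c₁ ≡ 0` forces `H₁K₂ − 3H₂K₁ = 0` on `(0,∞)` (continuity of the profiles' jets). -/
def OrderOneSilenceLinks : Prop :=
  ∀ (H₁ H₂ : ℝ → ℝ) (a : E3) (Q : E3 →L[ℝ] E3), PairAdmissible H₁ H₂ a Q → ¬ IsCoaxial a Q →
    (∀ y : E3, (H₁ ‖y‖ * vortAmpL 2 H₂ ‖y‖ - 3 * (H₂ ‖y‖ * vortAmpL 1 H₁ ‖y‖)) * det3 y a (Q y) = 0) →
    IsLinked H₁ H₂

/-- S-X «COAXIAL PAIR IS AXISYMMETRIC» (support, S): `Q` zonal about `a` ⇒ both pieces, hence the pair, commute with rotations about `a`. -/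
def CoaxialPairAxisym : Prop :=
  ∀ (H₁ H₂ : ℝ → ℝ) (a : E3) (Q : E3 →L[ℝ] E3) (x₀ : E3), PairAdmissible H₁ H₂ a Q → IsCoaxial a Q →
    IsSliceAxisymmetric (pairShell H₁ H₂ a Q x₀) x₀

/-! ## Where it breaks: order two -/

/-- BRIDGE O2a «OBLIQUE VIRIAL RIGIDITY» (M–L; the heart of the line).  L = CARD §3–§4: (i) PARITY — a term of `c₂` with amplitudes `A^iB^j`
(`i + j = 3`) is a function of parity `(−1)^j`, so the odd channel `V₃` carries only `A²B` and `B³` terms, and the `B³` part of `c₂` is LITERALLY the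
lone quadrupole shell's `c₂ = K₂{Y_Q, α₂²|∇Y_Q|² − r∂_r p₂₂}` (g11-1 ORDER-TWO LAW); (ii) WEIGHTS — `A` is `O(2)_a`-invariant and `Y_Q` has weights
`±1, ±2` only (`Q_aa = 0`), so `A²B` terms live in weights `±1, ±2` of `V₃`; hence the weight-`0` and weight-`±3` components of `c₂|_{V₃}` are
`e₃(r)·W₀` and `e₃(r)·W_{±3}` with `W = {Y_Q,|∇Y_Q|²} ∈ V₃` and `e₃` the lone shell's channel functional (engine j324042, case G: channel 3 has
exactly the two functionals `Φ_{3,0}` (`A²B` + pressure) and `Φ_{3,1} = V(H₂³ + (2r/3)H₂²H₂′ + (r²/9)H₂H₂′²) + pressure = e₃/27`); (iii) SHAPE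
COMPUTATION — in the normal form `a = e_z`, `Y_Q = xz + μ(cos2φ (x²−y²) + 2 sin2φ · xy)` one finds `W₀ = c₀ μ sin2φ` (`∝ det[a,Qa,Q²a]`) and
`W_3 = i c₃(1 − 8μ² e^{4iφ})` (`c₀, c₃ ≠ 0`; script weight_iso.py), which vanish together iff `sin2φ = 0 ∧ μ² = 1/8` iff `Q` is the MAGIC-ANGLE
UNIAXIAL quadrupole — excluded by `IsOblique`; (iv) so `e₃ ≡ 0` on `(0,∞)`, and g11-1's VIRIAL LEMMA (`∫₀^∞ r^{L−1}e_L = 0` for the pressure part,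
`K₂ ≠ 0` densely by analyticity) gives `∫₀^∞ r α₂² = 0`, `α₂ = rH₂′ + 3H₂ ≡ 0`, `H₂ = c r^{−3}`, `H₂ ≡ 0`.  Only the SECOND jet is used.  M = formal
second jet = one-sided jet of the classical solution.  WHY IT MIGHT FAIL: (i)–(ii) are a hand selection-rule argument checked exactly on three
sample shapes (j323459/j324042 cases A, B, G), (iii) is a float computation with `1e−15` residuals — an algebra slip would move the excluded shape,
not the method. -/
def ObliqueVirialRigidity : Prop :=
  ∀ (t₀ T : ℝ) (u : ℝ → E3 → E3) (p : ℝ → E3 → ℝ) (x₀ a : E3) (Q : E3 →L[ℝ] E3) (H₁ H₂ : ℝ → ℝ),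
    t₀ < T →
    Literature.Analysis.FluidPDE.IsClassicalNSSolutionOn (Set.Ico t₀ T) 1 0 u p →
    (∀ t ∈ Set.Ico t₀ T, Tendsto (p t) (cocompact E3) (𝓝 0)) →
    (∀ x : E3, ContDiffWithinAt ℝ 2 (fun t => threadingFlux u x₀ t x) (Set.Ici t₀) t₀) →
    PairAdmissible H₁ H₂ a Q → IsOblique a Q → u t₀ = pairShell H₁ H₂ a Q x₀ → AnalyticOnNhd ℝ H₂ (Set.Ioi 0) →
    (∀ x : E3, iteratedDerivWithin 2 (fun t => threadingFlux u x₀ t x) (Set.Ici t₀) t₀ = 0) →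
    IsNullProfile H₂

/-- BRIDGE O2b «EQUATORIAL DICHOTOMY» (M–L).  L = CARD §3, §5: for `Qa = 0` (`Y_Q` of weight `±2` only) channel `V₂` of `c₂` consists of the
QUAD LAW ALONE — `A²B` terms are odd (channel 3), `AB²` terms have weights `0, ±4`, and the weight-`0` (zonal) component vanishes because `c₂` is odd
under the reflection of `O(2)_a` fixing `Q` (engine j324042 case A: the cubic+pressure part of `c₂` has NO channel-2 component) — so order-two silence
gives EXACTLY `V′·(H₁H₂ + r(H₁H₂′ − H₁′H₂)) = V′H₁²(rH₂/H₁)′ ≡ 0` (QUAD LAW = polarisation of the order-one law along the linked family, `V″`, `V²`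
terms cancel; exact check j324042 all cases).  With analytic profiles: `V ≡ c` on `(0,∞)` or `rH₂ = c′H₁`; both profiles are smooth-even at `0` and
`H₁(0) ≠ 0` unless `H₁ ≡ 0` near `0`, so `c′ = 0`; `V ≡ c ≥ 0` admits no regular decaying non-null `H₁` (`K₁ = cH₁`), and `c < 0` is the HELMHOLTZ
pair.  M = formal jet = one-sided jet.  WHY IT MIGHT FAIL: the reflection-parity step is checked on one shape (case A) and argued by symmetry; the
analytic alternative needs `H₁ > 0` near `0` or the order-of-vanishing bookkeeping at `0` (smooth-even ⇒ `rH₂/H₁` odd ⇒ `c′ = 0` when `H₁ ≢ 0`). -/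
def EquatorialDichotomy : Prop :=
  ∀ (t₀ T : ℝ) (u : ℝ → E3 → E3) (p : ℝ → E3 → ℝ) (x₀ a : E3) (Q : E3 →L[ℝ] E3) (H₁ H₂ : ℝ → ℝ),
    t₀ < T →
    Literature.Analysis.FluidPDE.IsClassicalNSSolutionOn (Set.Ico t₀ T) 1 0 u p →
    (∀ t ∈ Set.Ico t₀ T, Tendsto (p t) (cocompact E3) (𝓝 0)) →
    (∀ x : E3, ContDiffWithinAt ℝ 2 (fun t => threadingFlux u x₀ t x) (Set.Ici t₀) t₀) →
    PairAdmissible H₁ H₂ a Q → IsEquatorial a Q → ¬ IsCoaxial a Q → u t₀ = pairShell H₁ H₂ a Q x₀ →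
    AnalyticOnNhd ℝ H₁ (Set.Ioi 0) → AnalyticOnNhd ℝ H₂ (Set.Ioi 0) → IsLinked H₁ H₂ →
    (∀ x : E3, iteratedDerivWithin 2 (fun t => threadingFlux u x₀ t x) (Set.Ici t₀) t₀ = 0) →
    IsNullProfile H₁ ∨ IsNullProfile H₂ ∨ IsHelmholtzLinked H₁ H₂

/-- S-H «THE HELMHOLTZ PAIR IS NOT SILENT» (support, S–M; needed only for EQUATORIAL `Q` — for oblique `Q` it is a case of O2a).  `c ≥ 0`: no non-null regular decaying profile with `K = cH` (growth / `a + br^{-3}`).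
`c = −k² < 0`: `H₁ = A j₁(kr)/r`, `H₂ = B j₂(√3kr)/r²` explicitly, and the order-two channel-`V₃` functional (it contains the quadrupole's own horn
`−3rVH₂α₂²` plus cross and pressure terms) does not vanish identically unless `B = 0`: numerics kit j324042 on the branch `k = 1` (exact `k`-scaling) — equatorial shape A: `Φ_{3,0}(r) =
B(c₂(r)A² + c₀(r)B²)` with `c₂(9/10), c₀(9/10) > 0` (no real projective root), `Φ_{4,0} ∝ AB²`; shape B: `Φ_{3,1}(r) = c(r)B³`, `c(9/10) ≠ 0`.  WHY IT
MIGHT FAIL: double-precision quadrature values (`~1e−4` vs quadrature error `≪ 1e−8`), two sample shapes; a general equatorial `Q` is shape A up to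
rotation and scale, so shape A is in fact every case. -/
def HelmholtzPairDead : Prop :=
  ∀ (t₀ T : ℝ) (u : ℝ → E3 → E3) (p : ℝ → E3 → ℝ) (x₀ a : E3) (Q : E3 →L[ℝ] E3) (H₁ H₂ : ℝ → ℝ),
    t₀ < T →
    Literature.Analysis.FluidPDE.IsClassicalNSSolutionOn (Set.Ico t₀ T) 1 0 u p →
    (∀ t ∈ Set.Ico t₀ T, Tendsto (p t) (cocompact E3) (𝓝 0)) →
    (∀ x : E3, ContDiffWithinAt ℝ 2 (fun t => threadingFlux u x₀ t x) (Set.Ici t₀) t₀) →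
    PairAdmissible H₁ H₂ a Q → ¬ IsCoaxial a Q → u t₀ = pairShell H₁ H₂ a Q x₀ → IsHelmholtzLinked H₁ H₂ →
    (∀ x : E3, iteratedDerivWithin 2 (fun t => threadingFlux u x₀ t x) (Set.Ici t₀) t₀ = 0) →
    IsNullProfile H₁ ∨ IsNullProfile H₂

/-- S-D «A DIPOLE SHELL IS AXISYMMETRIC» (support, S; about the axis `a` through `x₀`). -/
def DipoleShellAxisym : Prop :=
  ∀ (H₁ : ℝ → ℝ) (a x₀ : E3), a ≠ 0 → VirialAdmissible 1 H₁ → IsSliceAxisymmetric (sepShellL H₁ (dipoleHarmonic a) x₀) x₀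

/-- S-Q «QUADRUPOLE SHELL ORDER-TWO RIGIDITY» (support here; = g10-2 THEOREM PH/PHR = g11-1 THEOREM SEP-OT2 at `l = 2`, reduced there to bridge V +
routine supports): a lone quadrupole shell silent to order two is axisymmetric. -/
def QuadShellOrderTwoRigidity : Prop :=
  ∀ (t₀ T : ℝ) (u : ℝ → E3 → E3) (p : ℝ → E3 → ℝ) (x₀ : E3) (Q : E3 →L[ℝ] E3) (H₂ : ℝ → ℝ),
    t₀ < T →
    Literature.Analysis.FluidPDE.IsClassicalNSSolutionOn (Set.Ico t₀ T) 1 0 u p →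
    (∀ t ∈ Set.Ico t₀ T, Tendsto (p t) (cocompact E3) (𝓝 0)) →
    (∀ x : E3, ContDiffWithinAt ℝ 2 (fun t => threadingFlux u x₀ t x) (Set.Ici t₀) t₀) →
    IsTracelessSymmetric Q → VirialAdmissible 2 H₂ → u t₀ = sepShellL H₂ (quadHarmonic Q) x₀ →
    (∀ x : E3, iteratedDerivWithin 2 (fun t => threadingFlux u x₀ t x) (Set.Ici t₀) t₀ = 0) →
    IsSliceAxisymmetric (u t₀) x₀

/-- SLICE RUNG «MIXED-PAIR ORDER-TWO RIGIDITY»: an admissible dipole+quadrupole pair (coaxial or transverse — `Q_aa = 0` and not the magic-angle uniaxial shape —, profiles analytic on `(0,∞)`),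
left-end slice of a classical solution with decaying pressure, whose threading flux vanishes to order two, is an axisymmetric slice.  Reduced below
(kernel-checked) to O1, O2 and the supports. -/
def MixedPairOrderTwoRigidity : Prop :=
  ∀ (t₀ T : ℝ) (u : ℝ → E3 → E3) (p : ℝ → E3 → ℝ) (x₀ a : E3) (Q : E3 →L[ℝ] E3) (H₁ H₂ : ℝ → ℝ),
    t₀ < T →
    Literature.Analysis.FluidPDE.IsClassicalNSSolutionOn (Set.Ico t₀ T) 1 0 u p →
    (∀ t ∈ Set.Ico t₀ T, Tendsto (p t) (cocompact E3) (𝓝 0)) →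
    (∀ x : E3, ContDiffWithinAt ℝ 2 (fun t => threadingFlux u x₀ t x) (Set.Ici t₀) t₀) →
    PairAdmissible H₁ H₂ a Q → (IsCoaxial a Q ∨ IsTransverse a Q) → u t₀ = pairShell H₁ H₂ a Q x₀ →
    AnalyticOnNhd ℝ H₁ (Set.Ioi 0) → AnalyticOnNhd ℝ H₂ (Set.Ioi 0) →
    (∀ x : E3, iteratedDerivWithin 1 (fun t => threadingFlux u x₀ t x) (Set.Ici t₀) t₀ = 0) →
    (∀ x : E3, iteratedDerivWithin 2 (fun t => threadingFlux u x₀ t x) (Set.Ici t₀) t₀ = 0) →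
    IsSliceAxisymmetric (u t₀) x₀

/-! ## Window level (the crux's own setting) -/

/-- BRIDGE O-W «PAIR WINDOW REDUCTION» (M–L): in a window of 27585 all of whose slices are admissible pairs over a fixed axis `a` and a fixed cleanly
transverse, non-coaxial `Q` (time-dependent profiles), every slice has analytic profiles (interior analyticity), all jets of the identically vanishing
flux vanish at interior times, and O1 + S-L + O2a/O2b apply slicewise. -/
def PairWindowReduction : Prop :=
  ∀ (S : Set ℝ), IsOpen S → ∀ (u : ℝ → E3 → E3) (x₀ : E3),
    ContinuousOn (Function.uncurry u) (S ×ˢ Set.univ) →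
    (∀ t ∈ S, Literature.Analysis.FluidPDE.VectorCalculus.IsDivFree (u t)) →
    (∀ s ∈ S, ∀ t ∈ S, s < t → ∀ x, u t x =
        Literature.Analysis.UnboundedOperators.heatExtension (u s) (t - s) x
          - Literature.Analysis.FluidPDE.oseenDuhamel 1 s u u t x) →
    (∀ τ ∈ S, ∃ B : ℝ, ∀ t ∈ S, t ≤ τ → ∀ x, ‖u t x‖ ≤ B) →
    (∀ t ∈ S, ∀ x, inner ℝ (Literature.Analysis.FluidPDE.curl (u t) x) (x - x₀) = 0) →
    ∀ (a : E3) (Q : E3 →L[ℝ] E3) (H₁f H₂f : ℝ → ℝ → ℝ), IsTransverse a Q → ¬ IsCoaxial a Q →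
    (∀ t ∈ S, PairAdmissible (H₁f t) (H₂f t) a Q ∧ u t = pairShell (H₁f t) (H₂f t) a Q x₀) →
    ∀ t ∈ S, IsNullProfile (H₁f t) ∨ IsNullProfile (H₂f t) ∨ IsHelmholtzLinked (H₁f t) (H₂f t)

/-- S-HW «HELMHOLTZ SLICES DO NOT OCCUR IN A SILENT WINDOW» (support, S–M; S-H at interior times). -/
def HelmholtzWindowDead : Prop :=
  ∀ (S : Set ℝ), IsOpen S → ∀ (u : ℝ → E3 → E3) (x₀ : E3),
    ContinuousOn (Function.uncurry u) (S ×ˢ Set.univ) →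
    (∀ t ∈ S, Literature.Analysis.FluidPDE.VectorCalculus.IsDivFree (u t)) →
    (∀ s ∈ S, ∀ t ∈ S, s < t → ∀ x, u t x =
        Literature.Analysis.UnboundedOperators.heatExtension (u s) (t - s) x
          - Literature.Analysis.FluidPDE.oseenDuhamel 1 s u u t x) →
    (∀ τ ∈ S, ∃ B : ℝ, ∀ t ∈ S, t ≤ τ → ∀ x, ‖u t x‖ ≤ B) →
    (∀ t ∈ S, ∀ x, inner ℝ (Literature.Analysis.FluidPDE.curl (u t) x) (x - x₀) = 0) →
    ∀ (a : E3) (Q : E3 →L[ℝ] E3) (H₁f H₂f : ℝ → ℝ → ℝ), ¬ IsCoaxial a Q →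
    (∀ t ∈ S, PairAdmissible (H₁f t) (H₂f t) a Q ∧ u t = pairShell (H₁f t) (H₂f t) a Q x₀) →
    ∀ t ∈ S, IsHelmholtzLinked (H₁f t) (H₂f t) → IsNullProfile (H₁f t) ∨ IsNullProfile (H₂f t)

/-- S-QW «QUADRUPOLE SLICE IN A SILENT WINDOW IS AXISYMMETRIC» (support, M–L; g11-1's bridge V-W + supports at `l = 2`, slice-locally). -/
def QuadShellWindowAxisym : Prop :=
  ∀ (S : Set ℝ), IsOpen S → ∀ (u : ℝ → E3 → E3) (x₀ : E3),
    ContinuousOn (Function.uncurry u) (S ×ˢ Set.univ) →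
    (∀ t ∈ S, Literature.Analysis.FluidPDE.VectorCalculus.IsDivFree (u t)) →
    (∀ s ∈ S, ∀ t ∈ S, s < t → ∀ x, u t x =
        Literature.Analysis.UnboundedOperators.heatExtension (u s) (t - s) x
          - Literature.Analysis.FluidPDE.oseenDuhamel 1 s u u t x) →
    (∀ τ ∈ S, ∃ B : ℝ, ∀ t ∈ S, t ≤ τ → ∀ x, ‖u t x‖ ≤ B) →
    (∀ t ∈ S, ∀ x, inner ℝ (Literature.Analysis.FluidPDE.curl (u t) x) (x - x₀) = 0) →
    ∀ t ∈ S, ∀ (Q : E3 →L[ℝ] E3) (H : ℝ → ℝ), IsTracelessSymmetric Q → VirialAdmissible 2 H →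
    u t = sepShellL H (quadHarmonic Q) x₀ → IsSliceAxisymmetric (u t) x₀

/-- WINDOW RUNG «MIXED-PAIR WINDOW RIGIDITY» = the crux 27585 with its hypotheses VERBATIM, restricted to windows all of whose slices are admissible
dipole+quadrupole pairs about `x₀` over a fixed axis and a fixed coaxial-or-transverse quadrupole shape (time-dependent profiles). -/
def MixedPairWindowRigidity : Prop :=
  ∀ (S : Set ℝ), IsOpen S → IsPreconnected S → ∀ (u : ℝ → E3 → E3) (x₀ : E3),
    ContinuousOn (Function.uncurry u) (S ×ˢ Set.univ) →
    (∀ t ∈ S, Literature.Analysis.FluidPDE.VectorCalculus.IsDivFree (u t)) →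
    (∀ s ∈ S, ∀ t ∈ S, s < t → ∀ x, u t x =
        Literature.Analysis.UnboundedOperators.heatExtension (u s) (t - s) x
          - Literature.Analysis.FluidPDE.oseenDuhamel 1 s u u t x) →
    (∀ τ ∈ S, ∃ B : ℝ, ∀ t ∈ S, t ≤ τ → ∀ x, ‖u t x‖ ≤ B) →
    (∀ t ∈ S, ∀ x, inner ℝ (Literature.Analysis.FluidPDE.curl (u t) x) (x - x₀) = 0) →
    (∃ (a : E3) (Q : E3 →L[ℝ] E3) (H₁f H₂f : ℝ → ℝ → ℝ), (IsCoaxial a Q ∨ IsTransverse a Q) ∧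
        ∀ t ∈ S, PairAdmissible (H₁f t) (H₂f t) a Q ∧ u t = pairShell (H₁f t) (H₂f t) a Q x₀) →
    ∃ A : E3 →L[ℝ] E3, (∀ x, inner ℝ (A x) x = 0) ∧ A ≠ 0 ∧
      ∀ t ∈ S, ∀ x, fderiv ℝ (u t) x (A (x - x₀)) - A (u t x) = 0

/-- S-QU «A UNIAXIAL QUADRUPOLE SHELL IS AXISYMMETRIC» (support, S; v1.4, critic P1 (iii); the twin of S-D about the quadrupole's own axis `b`:
`sepShellL H (quadHarmonic Q) x₀ = curl curl (c H(|y|)(3(b·y)² − |b|²|y|²) y)` is invariant under rotations about `x₀ + ℝb`; `Q = 0`/`c = 0` gives the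
zero field, axisymmetric by `isSliceAxisymmetric_of_eq_zero`). -/
def UniaxialQuadShellAxisym : Prop :=
  ∀ (Q : E3 →L[ℝ] E3) (H : ℝ → ℝ) (x₀ : E3), IsUniaxial Q → VirialAdmissible 2 H →
    IsSliceAxisymmetric (sepShellL H (quadHarmonic Q) x₀) x₀

end Summit.NavierStokesRegularity.NavierStokesRegularity.Theorems.UnthreadedRigidity.MixedPair
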